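import Summits.QuantumFields.YangMills.Theorems.ColdStartUniversalityColdStartSolutionsExistTangentInst
import HarnessLib

/-!
# Route `ColdStartUniversality`, support item S (stmt-QuantumFields-24811), line `piwiener`:
# stub B from the generic tangent statement B1′ (with `L²(sup)` diffusion coefficients)

Helper file (lead `ym-line-csu-p1`): the variant `frobenius_preserved_of_tangent'` of
`frobenius_preserved_of_tangent` (`…TangentInst`) in which the generic statement `hT` (the registered stub
`stub_tangentSumSq`, skeleton v7) additionally assumes `E[sup_{s≤t} σ_{k,n}(s)²] < ∞`; for ambient solutions
this follows from the `L²(sup)` bound of `X` and the linear growth of tame coefficients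
(`hsForm_coeff_linearGrowth`).  No definition, no sorry.  RECORD-rung plumbing; nothing here bears on
the Yang–Mills mass gap. -/

set_option autoImplicit false

noncomputable section

namespace Summit.QuantumFields.YangMills.Theorems.ColdStartUniversality

open MeasureTheory ProbabilityTheory Filter Topology Finset Matrix Complex
open scoped NNReal ENNReal BigOperators ComplexConjugate
open Literature.Probability.Process
open Literature.MathematicalPhysics.QuantumFieldTheory

/-- **Stub B from the generic tangent theorem B1′** (variant of `frobenius_preserved_of_tangent` whose
hypothesis `hT` also assumes square-integrable running suprema of the diffusion coefficients).  Let `S` be a link SDE on `M₂(ℂ)^E` with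
squared-Frobenius Lipschitz coefficients satisfying the tangency identities
`2⟨b_e(Q), Q_e⟩ + Σₙ ‖σ_{e,n}(Q)‖² = 0`, `⟨σ_{e,n}(Q), Q_e⟩ = 0`; let `X` be an ambient solution on a
probability space with a flat Brownian motion (entrywise progressive, a.s. continuous, `L²(sup)`,
entrywise Itô equations from `Q₀`).  If the generic statement `hT` ("tangent Itô systems keep the sum
of squares", the registered stub `stub_tangentSumSq`) holds, then a.s. `‖X_e(t)‖_F² = ‖Q₀,e‖_F²` for all
`t, e` — apply `hT` link by link in the `8` real coordinates `Re/Im X_e,ij`. [folklore] -/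
theorem frobenius_preserved_of_tangent'
    (hT : ∀ {Ω : Type} [MeasurableSpace Ω] {P : Measure Ω} [IsProbabilityMeasure P] {d : ℕ}
      {W : ℝ≥0 → Ω → (Fin d → ℝ)} (hW : IsBrownianVec W P) {ι κ : Type} [Fintype ι] [Fintype κ]
      (c : κ → Fin d) (_hc : Function.Injective c)
      (Y : ι → ℝ≥0 → Ω → ℝ) (b : ι → ℝ≥0 → Ω → ℝ) (σ : ι → κ → ℝ≥0 → Ω → ℝ)
      (J : ι → κ → ℝ≥0 → Ω → ℝ) (y₀ : ι → ℝ),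
      (∀ k, IsStronglyProgressive hW.natFiltration (Y k)) →
      (∀ k, IsStronglyProgressive hW.natFiltration (b k)) →
      (∀ k n, IsStronglyProgressive hW.natFiltration (σ k n)) →
      (∀ᵐ ω ∂P, ∀ k, Continuous fun t => Y k t ω) →
      (∀ᵐ ω ∂P, ∀ k, Continuous fun t => b k t ω) →
      (∀ᵐ ω ∂P, ∀ k n, Continuous fun t => σ k n t ω) →
      (∀ k n (t : ℝ≥0), sqErr (σ k n) 0 P t ≠ ⊤) →
      (∀ k n (t : ℝ≥0), ∫⁻ ω, ⨆ s ∈ Set.Iic t, ENNReal.ofReal (σ k n s ω ^ 2) ∂P < ⊤) →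
      (∀ k n, IsItoIntegral (σ k n) (fun t ω => W t ω (c n)) (J k n) hW.natFiltration P) →
      (∀ᵐ ω ∂P, ∀ (t : ℝ≥0) (k : ι),
        Y k t ω = y₀ k + (∫ s in (0 : ℝ)..t, b k s.toNNReal ω) + ∑ n, J k n t ω) →
      (∀ (t : ℝ≥0) (ω : Ω), 2 * ∑ k, Y k t ω * b k t ω + ∑ k, ∑ n, σ k n t ω ^ 2 = 0) →
      (∀ (t : ℝ≥0) (ω : Ω) (n : κ), ∑ k, Y k t ω * σ k n t ω = 0) →
      ∀ᵐ ω ∂P, ∀ t : ℝ≥0, ∑ k, Y k t ω ^ 2 = ∑ k, y₀ k ^ 2)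
    {Ω : Type} {mΩ : MeasurableSpace Ω} {P : Measure Ω} [IsProbabilityMeasure P] {L : ℕ} [NeZero L]
    {W : ℝ≥0 → Ω → (Edge 3 L × NoiseIdx 2 → ℝ)} (hW : IsFlatBrownian W P)
    (S : LinkSDE 3 L 2 (NoiseIdx 2)) {K : ℝ}
    (hSd : ∀ (Q Q' : MatrixConfig 3 L 2) (e : Edge 3 L),
      hsForm 2 (S.drift Q e - S.drift Q' e) (S.drift Q e - S.drift Q' e) ≤
        K * ∑ e', hsForm 2 (Q e' - Q' e') (Q e' - Q' e'))
    (hSn : ∀ (Q Q' : MatrixConfig 3 L 2) (e : Edge 3 L) (n : NoiseIdx 2),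
      hsForm 2 (S.noise Q e n - S.noise Q' e n) (S.noise Q e n - S.noise Q' e n) ≤
        K * ∑ e', hsForm 2 (Q e' - Q' e') (Q e' - Q' e'))
    (hT1 : ∀ (Q : MatrixConfig 3 L 2) (e : Edge 3 L),
      2 * hsForm 2 (S.drift Q e) (Q e) + ∑ n, hsForm 2 (S.noise Q e n) (S.noise Q e n) = 0)
    (hT2 : ∀ (Q : MatrixConfig 3 L 2) (e : Edge 3 L) (n : NoiseIdx 2), hsForm 2 (S.noise Q e n) (Q e) = 0)
    (Q₀ : MatrixConfig 3 L 2) {X : ℝ≥0 → Ω → MatrixConfig 3 L 2}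
    (hXp : ∀ e i j, IsStronglyProgressive hW.natFiltration (fun t ω => (X t ω e i j).re) ∧
      IsStronglyProgressive hW.natFiltration (fun t ω => (X t ω e i j).im))
    (hXc : ∀ᵐ ω ∂P, Continuous fun t => X t ω)
    (hX2 : ∀ t : ℝ≥0, ∫⁻ ω, ⨆ s ∈ Set.Iic t, ENNReal.ofReal (∑ e, hsForm 2 (X s ω e) (X s ω e)) ∂P < ∞)
    {J : Edge 3 L → NoiseIdx 2 → Fin 2 → Fin 2 → ℝ≥0 → Ω → ℂ}
    (hJ : ∀ e n i j, IsItoIntegralC (fun t ω => S.noise (X t ω) e n i j) (fun t ω => W t ω (e, n))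
      (J e n i j) hW.natFiltration P)
    (hXeq : ∀ᵐ ω ∂P, ∀ (t : ℝ≥0) (e : Edge 3 L) (i j : Fin 2),
      X t ω e i j = Q₀ e i j + (∫ s in (0 : ℝ)..t, S.drift (X s.toNNReal ω) e i j) + ∑ n, J e n i j t ω) :
    ∀ᵐ ω ∂P, ∀ (t : ℝ≥0) (e : Edge 3 L), hsForm 2 (X t ω e) (X t ω e) = hsForm 2 (Q₀ e) (Q₀ e) := by
  classical
  have hfil := natFiltration_flat_eq hW
  -- continuity of the coefficients
  have hSdc : ∀ e, Continuous fun Q : MatrixConfig 3 L 2 => S.drift Q e := fun e =>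
    continuous_of_hsForm_lipschitz fun Q Q' => hSd Q Q' e
  have hSnc : ∀ e n, Continuous fun Q : MatrixConfig 3 L 2 => S.noise Q e n := fun e n =>
    continuous_of_hsForm_lipschitz fun Q Q' => hSn Q Q' e n
  -- it suffices to treat one link at a time
  suffices hlink : ∀ e : Edge 3 L, ∀ᵐ ω ∂P, ∀ t : ℝ≥0, hsForm 2 (X t ω e) (X t ω e) = hsForm 2 (Q₀ e) (Q₀ e) by
    have h := ae_all_iff.2 hlink
    filter_upwards [h] with ω hω t e using hω e t
  intro e
  -- the data of the generic statement, in the real coordinates `(i, j, re/im)` of the link `e`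
  have hres := hT (W := fun t ω k => W t ω ((Fintype.equivFin (Edge 3 L × NoiseIdx 2)).symm k)) hW
    (ι := Fin 2 × Fin 2 × Bool) (κ := NoiseIdx 2)
    (fun n => Fintype.equivFin (Edge 3 L × NoiseIdx 2) (e, n))
    (fun n n' h => by simpa using (Fintype.equivFin (Edge 3 L × NoiseIdx 2)).injective h)
    (fun k t ω => if k.2.2 then (X t ω e k.1 k.2.1).im else (X t ω e k.1 k.2.1).re)
    (fun k t ω => if k.2.2 then (S.drift (X t ω) e k.1 k.2.1).im else (S.drift (X t ω) e k.1 k.2.1).re)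
    (fun k n t ω => if k.2.2 then (S.noise (X t ω) e n k.1 k.2.1).im else (S.noise (X t ω) e n k.1 k.2.1).re)
    (fun k n t ω => if k.2.2 then (J e n k.1 k.2.1 t ω).im else (J e n k.1 k.2.1 t ω).re)
    (fun k => if k.2.2 then (Q₀ e k.1 k.2.1).im else (Q₀ e k.1 k.2.1).re)
    ?_ ?_ ?_ ?_ ?_ ?_ ?_ ?_ ?_ ?_ ?_ ?_
  · -- conclusion: the two sums of squares are the Frobenius norms
    filter_upwards [hres] with ω hω t
    have h := hω t
    rw [sum_reIm_sq_eq_hsForm (X t ω e), sum_reIm_sq_eq_hsForm (Q₀ e)] at h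
    exact h
  · -- coordinates progressive
    rintro ⟨i, j, β⟩
    rw [← hfil]
    cases β
    · simpa using (hXp e i j).1
    · simpa using (hXp e i j).2
  · -- drifts progressive
    rintro ⟨i, j, β⟩
    rw [← hfil]
    cases β
    · simpa using isStronglyProgressive_coeff_re (hSdc e) (fun e i j => (hXp e i j).1) (fun e i j => (hXp e i j).2) i j
    · simpa using isStronglyProgressive_coeff_im (hSdc e) (fun e i j => (hXp e i j).1) (fun e i j => (hXp e i j).2) i j
  · -- diffusion coefficients progressive
    rintro ⟨i, j, β⟩ n
    rw [← hfil]
    cases β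
    · simpa using isStronglyProgressive_coeff_re (hSnc e n) (fun e i j => (hXp e i j).1) (fun e i j => (hXp e i j).2) i j
    · simpa using isStronglyProgressive_coeff_im (hSnc e n) (fun e i j => (hXp e i j).1) (fun e i j => (hXp e i j).2) i j
  · -- coordinates continuous
    filter_upwards [hXc] with ω hω
    rintro ⟨i, j, β⟩
    have hij : Continuous fun t => X t ω e i j :=
      ((continuous_apply j).comp ((continuous_apply i).comp ((continuous_apply e).comp hω)))
    cases β
    · simp only [Bool.false_eq_true, ite_false]
      exact Complex.continuous_re.comp hij
    · simp only [ite_true]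
      exact Complex.continuous_im.comp hij
  · -- drifts continuous
    filter_upwards [hXc] with ω hω
    rintro ⟨i, j, β⟩
    have hij : Continuous fun t => S.drift (X t ω) e i j :=
      ((continuous_apply j).comp ((continuous_apply i).comp ((hSdc e).comp hω)))
    cases β
    · simp only [Bool.false_eq_true, ite_false]
      exact Complex.continuous_re.comp hij
    · simp only [ite_true]
      exact Complex.continuous_im.comp hij
  · -- diffusion coefficients continuous
    filter_upwards [hXc] with ω hω
    rintro ⟨i, j, β⟩ n
    have hij : Continuous fun t => S.noise (X t ω) e n i j :=
      ((continuous_apply j).comp ((continuous_apply i).comp ((hSnc e n).comp hω)))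
    cases β
    · simp only [Bool.false_eq_true, ite_false]
      exact Complex.continuous_re.comp hij
    · simp only [ite_true]
      exact Complex.continuous_im.comp hij
  · -- square integrability of the diffusion coefficients
    rintro ⟨i, j, β⟩ n t
    have h := sqErr_coeff_entry_ne_top (f := fun Q => S.noise Q e n) (fun Q Q' => hSn Q Q' e n) hX2 i j t
    cases β
    · simpa using h.1
    · simpa using h.2
  · -- running suprema of the diffusion coefficients are integrable (linear growth + `L²(sup)` of `X`)
    rintro ⟨i, j, β⟩ n t
    have hgrow := fun Q => hsForm_coeff_linearGrowth (f := fun Q => S.noise Q e n) (fun Q Q' => hSn Q Q' e n) Q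
    set Kp : ℝ := max K 0 with hKp
    have hpt : ∀ ω, (⨆ s ∈ Set.Iic t, ENNReal.ofReal
        ((fun (k : Fin 2 × Fin 2 × Bool) (n : NoiseIdx 2) (t : ℝ≥0) (ω : Ω) =>
          if k.2.2 then (S.noise (X t ω) e n k.1 k.2.1).im else (S.noise (X t ω) e n k.1 k.2.1).re) (i, j, β) n s ω ^ 2)) ≤
        ENNReal.ofReal (2 * hsForm 2 (S.noise 0 e n) (S.noise 0 e n)) +
          ENNReal.ofReal (2 * Kp) * ⨆ s ∈ Set.Iic t, ENNReal.ofReal (∑ e', hsForm 2 (X s ω e') (X s ω e')) := by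
      intro ω
      refine iSup₂_le fun s hs => ?_
      have hsum0 : 0 ≤ ∑ e', hsForm 2 (X s ω e') (X s ω e') := Finset.sum_nonneg fun _ _ => hsForm_self_nonneg _
      have h1 : (if β then (S.noise (X s ω) e n i j).im else (S.noise (X s ω) e n i j).re) ^ 2 ≤
          hsForm 2 (S.noise (X s ω) e n) (S.noise (X s ω) e n) := by
        cases β
        · exact sq_re_le_hsForm _ i j
        · exact sq_im_le_hsForm _ i j
      have h2 : hsForm 2 (S.noise (X s ω) e n) (S.noise (X s ω) e n) ≤
          2 * hsForm 2 (S.noise 0 e n) (S.noise 0 e n) + 2 * Kp * ∑ e', hsForm 2 (X s ω e') (X s ω e') := by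
        refine (hgrow (X s ω)).trans ?_
        have : 2 * K * ∑ e', hsForm 2 (X s ω e') (X s ω e') ≤ 2 * Kp * ∑ e', hsForm 2 (X s ω e') (X s ω e') :=
          mul_le_mul_of_nonneg_right (by linarith [le_max_left K 0]) hsum0
        linarith
      calc ENNReal.ofReal ((if β then (S.noise (X s ω) e n i j).im else (S.noise (X s ω) e n i j).re) ^ 2)
          ≤ ENNReal.ofReal (2 * hsForm 2 (S.noise 0 e n) (S.noise 0 e n) + 2 * Kp * ∑ e', hsForm 2 (X s ω e') (X s ω e')) :=
            ENNReal.ofReal_le_ofReal (h1.trans h2)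
        _ = ENNReal.ofReal (2 * hsForm 2 (S.noise 0 e n) (S.noise 0 e n)) +
              ENNReal.ofReal (2 * Kp) * ENNReal.ofReal (∑ e', hsForm 2 (X s ω e') (X s ω e')) := by
            rw [ENNReal.ofReal_add (by positivity [hsForm_self_nonneg (S.noise 0 e n)])
              (mul_nonneg (by positivity) hsum0), ENNReal.ofReal_mul (p := 2 * Kp) (by positivity)]
        _ ≤ _ := by
            gcongr
            exact le_iSup₂_of_le s hs le_rfl
    refine (lintegral_mono hpt).trans_lt ?_
    rw [lintegral_add_left measurable_const, lintegral_const, lintegral_const_mul' _ _ ENNReal.ofReal_ne_top]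
    exact ENNReal.add_lt_top.2 ⟨ENNReal.mul_lt_top ENNReal.ofReal_lt_top (measure_lt_top _ _),
      ENNReal.mul_lt_top ENNReal.ofReal_lt_top (hX2 t)⟩
  · -- the Itô integrals
    rintro ⟨i, j, β⟩ n
    rw [← hfil]
    have h := hJ e n i j
    cases β
    · simpa [IsItoIntegralC] using h.1
    · simpa [IsItoIntegralC] using h.2
  · -- the integral equations, real and imaginary parts
    filter_upwards [hXeq, hXc] with ω hωeq hωc t
    rintro ⟨i, j, β⟩
    have hint : IntervalIntegrable (fun s : ℝ => S.drift (X s.toNNReal ω) e i j) volume 0 t :=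
      (((continuous_apply j).comp (continuous_apply i)).comp
        ((hSdc e).comp (hωc.comp continuous_real_toNNReal))).intervalIntegrable _ _
    have h := hωeq t e i j
    cases β
    · have hre := intervalIntegral.intervalIntegral_re hint
      simp only [RCLike.re_to_complex] at hre
      have h' := congrArg Complex.re h
      simp only [Complex.add_re, Complex.re_sum, ← hre] at h'
      simpa using h'
    · have him := intervalIntegral.intervalIntegral_im hint
      simp only [RCLike.im_to_complex] at him
      have h' := congrArg Complex.im h
      simp only [Complex.add_im, Complex.im_sum, ← him] at h'
      simpa using h'
  · -- first tangency identity
    intro t ω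
    have h1 : ∑ k : Fin 2 × Fin 2 × Bool,
        (if k.2.2 then (X t ω e k.1 k.2.1).im else (X t ω e k.1 k.2.1).re) *
          (if k.2.2 then (S.drift (X t ω) e k.1 k.2.1).im else (S.drift (X t ω) e k.1 k.2.1).re) =
        hsForm 2 (S.drift (X t ω) e) (X t ω e) := by
      rw [sum_reIm_mul_eq_hsForm, hsForm_comm]
    have h2 : ∑ k : Fin 2 × Fin 2 × Bool, ∑ n,
        (if k.2.2 then (S.noise (X t ω) e n k.1 k.2.1).im else (S.noise (X t ω) e n k.1 k.2.1).re) ^ 2 =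
        ∑ n, hsForm 2 (S.noise (X t ω) e n) (S.noise (X t ω) e n) := by
      rw [Finset.sum_comm]
      exact Finset.sum_congr rfl fun n _ => sum_reIm_sq_eq_hsForm _
    rw [h1, h2]
    exact hT1 (X t ω) e
  · -- second tangency identity
    intro t ω n
    rw [sum_reIm_mul_eq_hsForm, hsForm_comm]
    exact hT2 (X t ω) e n

end Summit.QuantumFields.YangMills.Theorems.ColdStartUniversality

end
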